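import Summits.Ventures.Crystal3D.StickySpheres.TetraCaps
import HarnessLib

/-!
# A fan of three tetrahedra about an edge cannot be bridged

Venture `Crystal3D` (cell `pub-crystal3d`, seat p2). Elementary Euclidean geometry in `ℝ³` by linear algebra (unit DIAMETER
convention), in the style of `TetraCaps.lean`.

* `eq_zero_of_inner_tripod` — three unit vectors with pairwise inner products `1/2` (a regular tetrahedron at the hub) span
  `ℝ³`: a vector orthogonal to all three vanishes.
* `no_tetra_fan_bridge` — balls `h, q` touch; the balls `v₂, v₀, v₃, v₁` all touch `h` and `q`, consecutive ones touch (three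
  regular tetrahedra `h q v₂ v₀`, `h q v₀ v₃`, `h q v₃ v₁` about the edge `hq`), and `v₂v₃`, `v₀v₁` do not overlap. Then no
  ball `w` touches `h` and the two end balls `v₁, v₂` without overlapping `q`: seen from `h`, the three contacts force
  `⟪w − h, q − h⟫ ∈ {1, 7/11}`, both `> 1/2`.
This is the seven-vertex fifteen-edge graph `FUZvw` — one of the two `K₅`/`K_{3,3}`-free fifteen-edge graphs on seven
vertices with minimum degree `≥ 3` that is NOT the contact graph of a `15`-contact packing of seven balls (the other is the
prism link); it is recorded here as groundwork for the seven-ball census at graph level.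

HONEST FRAMING: folklore solid geometry, formalised; nothing enumerative and nothing about crystallization is claimed.
-/

noncomputable section

open Real RealInnerProductSpace

namespace Summit.Ventures.Crystal3D

/-- Three unit vectors with pairwise inner products `1/2` span `ℝ³`: a vector orthogonal to all of them is zero.
[folklore] -/
theorem eq_zero_of_inner_tripod {u v t w : EuclideanSpace ℝ (Fin 3)} (huu : ⟪u, u⟫ = 1) (hvv : ⟪v, v⟫ = 1)
    (htt : ⟪t, t⟫ = 1) (huv : ⟪u, v⟫ = 1 / 2) (hut : ⟪u, t⟫ = 1 / 2) (hvt : ⟪v, t⟫ = 1 / 2) (hwu : ⟪u, w⟫ = 0)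
    (hwv : ⟪v, w⟫ = 0) (hwt : ⟪t, w⟫ = 0) : w = 0 := by
  by_contra hw
  obtain ⟨α, β, γ, hne, hrel⟩ := exists_rel_of_orthogonal hw hwu hwv hwt
  have h1 := inner_rel_eq_zero (v := u) hrel
  have h2 := inner_rel_eq_zero (v := v) hrel
  have h3 := inner_rel_eq_zero (v := t) hrel
  have hvu : ⟪v, u⟫ = 1 / 2 := by rw [real_inner_comm]; exact huv
  have htu : ⟪t, u⟫ = 1 / 2 := by rw [real_inner_comm]; exact hut
  have htv : ⟪t, v⟫ = 1 / 2 := by rw [real_inner_comm]; exact hvt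
  rw [huu, hvu, htu] at h1
  rw [huv, hvv, htv] at h2
  rw [hut, hvt, htt] at h3
  have hα : α = 0 := by linarith
  have hβ : β = 0 := by linarith
  have hγ : γ = 0 := by linarith
  rcases hne with h | h | h
  · exact h hα
  · exact h hβ
  · exact h hγ

/-- **No bridge over a fan of three tetrahedra.** With `h, q` touching, `v₂, v₀, v₃, v₁` touching both `h` and `q`,
`v₂v₀`, `v₀v₃`, `v₃v₁` touching and `v₂v₃`, `v₀v₁` not overlapping, no ball `w` touches `h`, `v₁` and `v₂` while not
overlapping `q`. [folklore] -/
theorem no_tetra_fan_bridge {h q v2 v0 v3 v1 w : EuclideanSpace ℝ (Fin 3)} (hhq : dist h q = 1) (hh2 : dist h v2 = 1)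
    (hh0 : dist h v0 = 1) (hh3 : dist h v3 = 1) (hh1 : dist h v1 = 1) (hq2 : dist q v2 = 1) (hq0 : dist q v0 = 1)
    (hq3 : dist q v3 = 1) (hq1 : dist q v1 = 1) (h20 : dist v2 v0 = 1) (h03 : dist v0 v3 = 1) (h31 : dist v3 v1 = 1)
    (hwh : dist w h = 1) (hw1 : dist w v1 = 1) (hw2 : dist w v2 = 1) (h23 : 1 ≤ dist v2 v3) (h01 : 1 ≤ dist v0 v1)
    (hwq : 1 ≤ dist w q) : False := by
  -- Gram data seen from the hub `h`
  have gQQ := inner_sub_sub_of_dist h q q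
  have g22 := inner_sub_sub_of_dist h v2 v2
  have g00 := inner_sub_sub_of_dist h v0 v0
  have g33 := inner_sub_sub_of_dist h v3 v3
  have g11 := inner_sub_sub_of_dist h v1 v1
  have gWW := inner_sub_sub_of_dist h w w
  have gQ2 := inner_sub_sub_of_dist h q v2
  have gQ0 := inner_sub_sub_of_dist h q v0
  have gQ3 := inner_sub_sub_of_dist h q v3
  have gQ1 := inner_sub_sub_of_dist h q v1
  have g20 := inner_sub_sub_of_dist h v2 v0
  have g03 := inner_sub_sub_of_dist h v0 v3
  have g31 := inner_sub_sub_of_dist h v3 v1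
  have g23 := inner_sub_sub_of_dist h v2 v3
  have g01 := inner_sub_sub_of_dist h v0 v1
  have gW1 := inner_sub_sub_of_dist h w v1
  have gW2 := inner_sub_sub_of_dist h w v2
  have gWQ := inner_sub_sub_of_dist h w q
  have h23' : 1 ≤ dist v2 v3 ^ 2 := one_le_pow₀ h23
  have h01' : 1 ≤ dist v0 v1 ^ 2 := one_le_pow₀ h01
  have hwq' : 1 ≤ dist w q ^ 2 := one_le_pow₀ hwq
  rw [dist_comm] at hhq hh2 hh0 hh3 hh1
  rw [hhq, hh2, hh0, hh3, hh1, hq2, hq0, hq3, hq1, h20, h03, h31, hwh, hw1, hw2, dist_self] at *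
  set Q := q - h
  set U2 := v2 - h
  set U0 := v0 - h
  set U3 := v3 - h
  set U1 := v1 - h
  set W := w - h
  -- the two reflections along the fan
  have e3 : U3 = (2 / 3 : ℝ) • (Q + U0) - U2 :=
    tetra_reflect (by rw [gQQ]; norm_num) (by rw [g00]; norm_num) (by rw [g22]; norm_num) (by rw [g33]; norm_num)
      (by rw [gQ0]; norm_num) (by rw [gQ2]; norm_num) (by rw [real_inner_comm, g20]; norm_num)
      (by rw [real_inner_comm, gQ3]; norm_num) (by rw [real_inner_comm, g03]; norm_num)
      (by rw [real_inner_comm, g23]; linarith)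
  have e1 : U1 = (2 / 3 : ℝ) • (Q + U3) - U0 :=
    tetra_reflect (by rw [gQQ]; norm_num) (by rw [g33]; norm_num) (by rw [g00]; norm_num) (by rw [g11]; norm_num)
      (by rw [gQ3]; norm_num) (by rw [gQ0]; norm_num) (by rw [real_inner_comm, g03]; norm_num)
      (by rw [real_inner_comm, gQ1]; norm_num) (by rw [real_inner_comm, g31]; norm_num)
      (by rw [real_inner_comm, g01]; linarith)
  -- the tripod `U0, U2, Q` and the three contacts of `w`
  have gW0 : ⟪U0, W⟫ = ⟪W, U0⟫ := real_inner_comm _ _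
  have g2W : ⟪U2, W⟫ = 1 / 2 := by rw [real_inner_comm, gW2]; norm_num
  have gW2' : ⟪W, U2⟫ = 1 / 2 := by rw [gW2]; norm_num
  have gQW : ⟪Q, W⟫ = ⟪W, Q⟫ := real_inner_comm _ _
  have g0Q : ⟪U0, Q⟫ = 1 / 2 := by rw [real_inner_comm, gQ0]; norm_num
  have g2Q : ⟪U2, Q⟫ = 1 / 2 := by rw [real_inner_comm, gQ2]; norm_num
  have g02 : ⟪U0, U2⟫ = 1 / 2 := by rw [real_inner_comm, g20]; norm_num
  have g20' : ⟪U2, U0⟫ = 1 / 2 := by rw [g20]; norm_num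
  have gQ0' : ⟪Q, U0⟫ = 1 / 2 := by rw [gQ0]; norm_num
  have gQ2' : ⟪Q, U2⟫ = 1 / 2 := by rw [gQ2]; norm_num
  have g00' : ⟪U0, U0⟫ = 1 := by rw [g00]; norm_num
  have g22' : ⟪U2, U2⟫ = 1 := by rw [g22]; norm_num
  have gQQ' : ⟪Q, Q⟫ = 1 := by rw [gQQ]; norm_num
  -- the contact with `v₁` gives `⟪W, U0⟫ = 2 ⟪W, Q⟫ − 3/2`
  have hW3 : ⟪W, U3⟫ = (2 / 3) * (⟪W, Q⟫ + ⟪W, U0⟫) - 1 / 2 := by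
    rw [e3, inner_sub_right, real_inner_smul_right, inner_add_right, gW2']
  have hxz : ⟪W, U0⟫ = 2 * ⟪W, Q⟫ - 3 / 2 := by
    have e : ⟪W, U1⟫ = (2 / 3) * (⟪W, Q⟫ + ⟪W, U3⟫) - ⟪W, U0⟫ := by
      rw [e1, inner_sub_right, real_inner_smul_right, inner_add_right]
    rw [gW1, hW3] at e
    linarith
  -- `W` lies in the span of the tripod: expand (coefficients `G⁻¹ (x, 1/2, z)`) and take the norm
  have hWexp : W = (2 * ⟪W, U0⟫ - (⟪W, U0⟫ + 1 / 2 + ⟪W, Q⟫) / 2) • U0 + (1 - (⟪W, U0⟫ + 1 / 2 + ⟪W, Q⟫) / 2) • U2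
      + (2 * ⟪W, Q⟫ - (⟪W, U0⟫ + 1 / 2 + ⟪W, Q⟫) / 2) • Q := by
    have hzv := eq_zero_of_inner_tripod g00' g22' gQQ' g02 g0Q g2Q
      (w := W - ((2 * ⟪W, U0⟫ - (⟪W, U0⟫ + 1 / 2 + ⟪W, Q⟫) / 2) • U0 + (1 - (⟪W, U0⟫ + 1 / 2 + ⟪W, Q⟫) / 2) • U2
        + (2 * ⟪W, Q⟫ - (⟪W, U0⟫ + 1 / 2 + ⟪W, Q⟫) / 2) • Q)) ?_ ?_ ?_
    · exact sub_eq_zero.1 hzv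
    · simp only [inner_sub_right, inner_add_right, real_inner_smul_right, gW0, g00', g02, g0Q]
      ring
    · simp only [inner_sub_right, inner_add_right, real_inner_smul_right, g2W, g22', g20', g2Q]
      ring
    · simp only [inner_sub_right, inner_add_right, real_inner_smul_right, gQW, gQQ', gQ0', gQ2']
      ring
  have key : (⟪W, Q⟫ - 1) * (11 * ⟪W, Q⟫ - 7) = 0 := by
    have e : ⟪W, W⟫ = ⟪W, (2 * ⟪W, U0⟫ - (⟪W, U0⟫ + 1 / 2 + ⟪W, Q⟫) / 2) • U0
        + (1 - (⟪W, U0⟫ + 1 / 2 + ⟪W, Q⟫) / 2) • U2 + (2 * ⟪W, Q⟫ - (⟪W, U0⟫ + 1 / 2 + ⟪W, Q⟫) / 2) • Q⟫ := by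
      rw [← hWexp]
    simp only [inner_add_right, real_inner_smul_right, gW2'] at e
    rw [gWW, hxz] at e
    linear_combination (-2 : ℝ) * e
  -- both roots exceed `1/2`, but `w` does not overlap `q`
  have hz1 : ⟪W, Q⟫ ≤ 1 / 2 := by linarith
  rcases mul_eq_zero.1 key with h1 | h1
  · linarith
  · linarith

end Summit.Ventures.Crystal3D

end
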